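import Mathlib
import Literature.NumberTheory.LFunctions.Zhang2022.TypedSection16BE
import HarnessLib

/-!
# Zhang (2022) §16 p. 93 u031 with the Rankin rate `O(ε₁)` — `Step16_u031Lε` (ZHANG-L WP16, RT16-int-3 (c))
# and the (16.15) bookkeeping edge re-proved from it (plain and at the RT-05 parameter)

Topic `Literature/NumberTheory/LFunctions/Zhang2022` (Landau–Siegel audit tree; verdict-neutral).
Y. Zhang, *Discrete mean estimates and the Landau–Siegel zero*, arXiv:2211.02515v1 (2022)
[Zhang2022LandauSiegel] — **an unrefereed manuscript under adjudication; the `def … : Prop` below is a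
READING of a display of §16, STATED NOT ASSERTED; nothing here asserts or denies Theorems 1–2.**

WHY (zl-w16-p8 finding F1, endorsed by zl-w16-plan RT16-int-3 (c), 2026-08-26T23:58:40Z; numbers): the
display after (16.13) (§16 p. 93, tex L4602; typed `Typed.Section16B.Step16_u031`, local reading
`Step16_u031L`) truncates the smooth part at `n₁ < T` "in a way similar to the proof of (15.20)" and prints
the error `O(D^{−c})`; the Rankin truncation over `D⁴`-smooth `n₁` (exponent `σ = c/(4𝓛)`, `T = e^{𝓛^{1.1}}`)
yields only `O(ε₁) = O(exp(−c𝓛^{1/10}))` — exactly what the manuscript itself prints at the §15 twin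
(p. 86, tex L4257; `Typed.Section15B.Inline15_Rankin`). The (16.15) budget `O(1/𝓛)` absorbs `ε₁`
(`e^{−c𝓛^{1/10}} ≤ 10!/(c¹⁰𝓛)`), so the chain to (16.15) is unaffected. This file types the derivable
reading `Step16_u031Lε` (= `Step16_u031L` with right-hand side `C·exp(−c·𝓛^{1/10})`) and re-proves the
summed edge: `eq16_15_of_repairLε : Step16_u031Lε → Step16_u037RL → Inline16_varpi2WeightSum → Eq16_15` and,
at the RT-05 parameter, `eq16_15E_of_repairLε e1pp : Step16_u031Lε → Step16_u037RLE e1pp →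
Inline16_varpi2WeightSum → Eq16_15E e1pp` (the former is the latter at `e1pp = e1ppj`, by `rfl`). Objects
of `TypedSection16B/16BLocal/16BE` are used BY NAME; no instance, no notation.

## References

* Y. Zhang, arXiv:2211.02515v1 (2022), §16 p. 93 (tex L4602), (16.15) p. 94; §15 p. 86 (tex L4257).
  [cite: Zhang2022LandauSiegel, §16 p.93, (16.15) p.94]
-/

noncomputable section

open Complex Real ComplexConjugate Filter Topology
open Literature.NumberTheory.LFunctions.Zhang2022
open Literature.NumberTheory.LFunctions.Zhang2022.Skeleton
open Literature.NumberTheory.LFunctions.Zhang2022.Typed.Section16A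

namespace Literature.NumberTheory.LFunctions.Zhang2022.Typed.Section16B

open scoped Classical in
/-- **u031 (display after (16.13), tex L4602), local reading, with the Rankin rate `O(ε₁)`**:
"`Σ_n b₁(n)ϖ₂ⱼ(n)/n = Σ_{n₁∈𝔫(𝔮), n₁<T} ϖ₂ⱼ(n₁)/n₁ · Σ_{(n,𝔮)=1} b₁(n₁n)ϖ₂ⱼ^loc(n)/n + O(ε₁)`",
`ε₁ = exp{−c𝓛^{1/10}}` (§7) — `Step16_u031L` with the error the Rankin truncation actually gives (print:
`O(D^{−c})`; §15 twin p. 86 prints `O(ε₁)`). NOT PRINTED in this form (F16B-1 local reading × RT16-int-3 (c)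
rate). CLAIM. [cite: Zhang2022LandauSiegel, §16 p.93] -/
def Step16_u031Lε (c' : ℝ) : Prop :=
  ∃ c : ℝ, 0 < c ∧ ∃ C : ℝ, ForAllLarge fun D _ χ => AssumptionA D χ → ∀ j ∈ ({1, 2} : Finset ℕ),
    ‖(∑ n ∈ Finset.Ico 1 ⌈bigP D⌉₊, b1coef c' χ n * varpi2 c' χ j n / (n : ℂ)) -
        ∑ n₁ ∈ (Finset.Ico 1 ⌈bigT D⌉₊).filter (fun n₁ => n₁ ∈ nset (frakq D)),
          varpi2 c' χ j n₁ / (n₁ : ℂ) *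
            ∑ n ∈ (Finset.Ico 1 ⌈bigP D⌉₊).filter (fun n => Nat.Coprime n (frakq D)),
              b1coef c' χ (n₁ * n) * varpi2loc c' χ j n / (n : ℂ)‖ ≤
      C * Real.exp (-c * ell D ^ (1 / 10 : ℝ))

/-- `Step16_u031L` (error `D^{−c}`) implies `Step16_u031Lε` (error `e^{−c𝓛^{1/10}}`): `D^{−c} =
e^{−c𝓛} ≤ e^{−c𝓛^{1/10}}` once `𝓛 ≥ 1`. [cite: Zhang2022LandauSiegel, §16 p.93] -/
theorem step16_u031Lε_of_L (c' : ℝ) (h : Step16_u031L c') : Step16_u031Lε c' := by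
  obtain ⟨c, hc, C, D₀, hC⟩ := h
  refine ⟨c, hc, max C 0, max D₀ ⌈Real.exp 1⌉₊, fun D _ χ hD hq hp hA j hj => ?_⟩
  have e := hC D χ (le_trans (le_max_left _ _) hD) hq hp hA j hj
  have hD1 : ⌈Real.exp 1⌉₊ ≤ D := le_trans (le_max_right _ _) hD
  have hexpD : Real.exp 1 ≤ D := le_trans (Nat.le_ceil _) (by exact_mod_cast hD1)
  have hDpos : (0 : ℝ) < D := lt_of_lt_of_le (Real.exp_pos _) hexpD
  have hℓ1 : 1 ≤ ell D := (Real.le_log_iff_exp_le hDpos).mpr hexpD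
  have hℓ0 : 0 ≤ ell D := by linarith
  refine le_trans e ?_
  have hrpow : (D : ℝ) ^ (-c) = Real.exp (-c * ell D) := by
    rw [Real.rpow_def_of_pos hDpos, ell]; ring_nf
  have hmono : Real.exp (-c * ell D) ≤ Real.exp (-c * ell D ^ (1 / 10 : ℝ)) := by
    rw [Real.exp_le_exp]
    have : ell D ^ (1 / 10 : ℝ) ≤ ell D := by
      calc ell D ^ (1 / 10 : ℝ) ≤ ell D ^ (1 : ℝ) :=
            Real.rpow_le_rpow_of_exponent_le hℓ1 (by norm_num)
        _ = ell D := Real.rpow_one _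
    nlinarith
  rw [hrpow]
  calc C * Real.exp (-c * ell D) ≤ max C 0 * Real.exp (-c * ell D) :=
        mul_le_mul_of_nonneg_right (le_max_left _ _) (Real.exp_nonneg _)
    _ ≤ max C 0 * Real.exp (-c * ell D ^ (1 / 10 : ℝ)) :=
        mul_le_mul_of_nonneg_left hmono (le_max_right _ _)

section EdgeEps


/-- `τ₃(n) ≥ 0`. [folklore] -/
private theorem tau3R_nonneg' (n : ℕ) : 0 ≤ tau3R n :=
  Finset.sum_nonneg fun _ _ => Nat.cast_nonneg _

/-- `τ₃(n) ≥ 1` for `n ≥ 1`. [folklore] -/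
private theorem one_le_tau3R' {n : ℕ} (hn : 1 ≤ n) : 1 ≤ tau3R n := by
  unfold tau3R
  have h1 : (1 : ℕ) ∈ n.divisors := Nat.one_mem_divisors.mpr (by omega)
  calc (1 : ℝ) = ((1 : ℕ).divisors.card : ℝ) := by simp
    _ ≤ ∑ m ∈ n.divisors, (m.divisors.card : ℝ) :=
        Finset.single_le_sum (f := fun m : ℕ => (m.divisors.card : ℝ)) (fun _ _ => Nat.cast_nonneg _) h1

/-- `⌈e^L⌉ ≤ D ⇒ L ≤ 𝓛`. [folklore] -/
private theorem le_ell_of_ceil_exp_le' {L : ℝ} {D : ℕ} (hD : ⌈Real.exp L⌉₊ ≤ D) : L ≤ ell D := by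
  have h : Real.exp L ≤ D := le_trans (Nat.le_ceil _) (by exact_mod_cast hD)
  exact (Real.le_log_iff_exp_le (lt_of_lt_of_le (Real.exp_pos _) h)).mpr h

/-- `0 < 𝓛 ⇒ 0 < D`. [folklore] -/
private theorem cast_pos_of_ell_pos {D : ℕ} (hℓ : 0 < ell D) : (0 : ℝ) < D := by
  have : ell D ≠ 0 := hℓ.ne'
  rw [ell] at this
  by_contra h
  push Not at h
  have h0 : (D : ℝ) = 0 := le_antisymm h (Nat.cast_nonneg D)
  exact this (by rw [h0, Real.log_zero])

/-- `D^{−c}𝓛⁶ ≤ 7!/(c⁷𝓛)` (`c, 𝓛 > 0`). [folklore] -/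
private theorem rpow_neg_mul_pow_six_le' {D : ℕ} {c : ℝ} (hc : 0 < c) (hℓ : 0 < ell D) :
    (D : ℝ) ^ (-c) * ell D ^ 6 ≤ (Nat.factorial 7 : ℝ) / c ^ 7 * (ell D)⁻¹ := by
  have hD := cast_pos_of_ell_pos hℓ
  rw [Real.rpow_def_of_pos hD, ← ell, show ell D * -c = -(c * ell D) by ring, Real.exp_neg]
  have hpos : 0 < c * ell D := mul_pos hc hℓ
  have h7 := Real.pow_div_factorial_le_exp (c * ell D) (le_of_lt hpos) 7
  have hexp : (Real.exp (c * ell D))⁻¹ ≤ (Nat.factorial 7 : ℝ) / (c * ell D) ^ 7 := by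
    rw [inv_le_comm₀ (Real.exp_pos _) (by positivity), inv_div]
    exact h7
  calc (Real.exp (c * ell D))⁻¹ * ell D ^ 6 ≤ (Nat.factorial 7 : ℝ) / (c * ell D) ^ 7 * ell D ^ 6 := by
        gcongr
    _ = (Nat.factorial 7 : ℝ) / c ^ 7 * (ell D)⁻¹ := by
        field_simp


/-- `exp(−c𝓛^{1/10}) ≤ 10!/(c¹⁰𝓛)` (`c, 𝓛 > 0`; from `x¹⁰/10! ≤ eˣ` at `x = c𝓛^{1/10}`). [folklore] -/
private theorem exp_neg_mul_rpow_tenth_le {D : ℕ} {c : ℝ} (hc : 0 < c) (hℓ : 0 < ell D) :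
    Real.exp (-c * ell D ^ (1 / 10 : ℝ)) ≤ (Nat.factorial 10 : ℝ) / c ^ 10 * (ell D)⁻¹ := by
  have hr0 : 0 < ell D ^ (1 / 10 : ℝ) := Real.rpow_pos_of_pos hℓ _
  have hpos : 0 < c * ell D ^ (1 / 10 : ℝ) := mul_pos hc hr0
  have h10 := Real.pow_div_factorial_le_exp (c * ell D ^ (1 / 10 : ℝ)) hpos.le 10
  have hpow : (ell D ^ (1 / 10 : ℝ)) ^ 10 = ell D := by
    rw [← Real.rpow_natCast, ← Real.rpow_mul hℓ.le]
    norm_num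
  have hx10 : (c * ell D ^ (1 / 10 : ℝ)) ^ 10 = c ^ 10 * ell D := by rw [mul_pow, hpow]
  rw [hx10] at h10
  rw [show -c * ell D ^ (1 / 10 : ℝ) = -(c * ell D ^ (1 / 10 : ℝ)) by ring, Real.exp_neg]
  have hfac : (0 : ℝ) < Nat.factorial 10 := by positivity
  rw [inv_le_comm₀ (Real.exp_pos _) (by positivity)]
  calc ((Nat.factorial 10 : ℝ) / c ^ 10 * (ell D)⁻¹)⁻¹ = c ^ 10 * ell D / Nat.factorial 10 := by
        field_simp
    _ ≤ Real.exp (c * ell D ^ (1 / 10 : ℝ)) := h10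

open scoped Classical in
/-- **The summed edge to (16.15) from the `ε₁`-rate u031, at the RT-05 parameter `e″ = e1pp`**
(G-L4t5-1 × F16B-1 × RT16-int-3 (c)): `Step16_u031Lε → Step16_u037RLE e1pp → Inline16_varpi2WeightSum →
Eq16_15E e1pp`; the bookkeeping of `eq16_15_of_repairL` with `e^{−c𝓛^{1/10}} ≤ 10!/(c¹⁰𝓛)` in place of
`D^{−c} ≤ 1/(c𝓛)`. [cite: Zhang2022LandauSiegel, §16 (16.15) p.94] -/
theorem eq16_15E_of_repairLε (e1pp : ℕ → ℂ) (c' : ℝ) (h31 : Step16_u031Lε c')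
    (h37 : Step16_u037RLE e1pp c') (hS : Inline16_varpi2WeightSum c') : Eq16_15E e1pp c' := by
  obtain ⟨c₁, hc₁, C₁, D₁, h31⟩ := h31
  obtain ⟨c₂, hc₂, C₂, D₂, h37⟩ := h37
  obtain ⟨C₃, D₃, hS⟩ := hS
  refine ⟨|C₁| * ((Nat.factorial 10 : ℝ) / c₁ ^ 10) + |C₂| * |C₃| * (1 + (Nat.factorial 7 : ℝ) / c₂ ^ 7),
    max (max D₁ D₂) (max D₃ ⌈Real.exp 1⌉₊), fun D _ χ hD hq hp hA j hj => ?_⟩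
  have hD₁ : D₁ ≤ D := le_trans (le_trans (le_max_left _ _) (le_max_left _ _)) hD
  have hD₂ : D₂ ≤ D := le_trans (le_trans (le_max_right _ _) (le_max_left _ _)) hD
  have hD₃ : D₃ ≤ D := le_trans (le_trans (le_max_left _ _) (le_max_right _ _)) hD
  have hℓ1 : 1 ≤ ell D :=
    le_ell_of_ceil_exp_le' (le_trans (le_trans (le_max_right _ _) (le_max_right _ _)) hD)
  have hℓ0 : 0 < ell D := by linarith
  have e31 := h31 D χ hD₁ hq hp hA j hj
  have eS := hS D χ hD₃ hq hp hA j hj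
  -- notation
  set F := (Finset.Ico 1 ⌈bigT D⌉₊).filter (fun n₁ => n₁ ∈ nset (frakq D)) with hF
  set X := ∑ n ∈ Finset.Ico 1 ⌈bigP D⌉₊, b1coef c' χ n * varpi2 c' χ j n / (n : ℂ) with hX
  set In : ℕ → ℂ := fun n₁ =>
    ∑ n ∈ (Finset.Ico 1 ⌈bigP D⌉₊).filter (fun n => Nat.Coprime n (frakq D)),
      b1coef c' χ (n₁ * n) * varpi2loc c' χ j n / (n : ℂ) with hIn
  -- the per-`n₁` bound
  have e37 : ∀ n₁ ∈ F, ‖In n₁ - frakeE e1pp j * nuConvChi χ n₁‖ ≤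
      |C₂| * (tau3R n₁ * (ell D ^ 7)⁻¹ + (D : ℝ) ^ (-c₂)) := by
    intro n₁ hn₁
    obtain ⟨hIco, hns⟩ := Finset.mem_filter.mp hn₁
    have h1 : 1 ≤ n₁ := (Finset.mem_Ico.mp hIco).1
    have hT : (n₁ : ℝ) < bigT D := Nat.lt_ceil.mp (Finset.mem_Ico.mp hIco).2
    have key := h37 D χ hD₂ hq hp hA j hj n₁ hns hT
    rw [nuConvChi_eq_sum_divisors χ h1]
    refine le_trans key (mul_le_mul_of_nonneg_right (le_abs_self C₂) ?_)
    have := tau3R_nonneg' n₁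
    positivity
  -- rewrite the difference
  have hsplit : X - frakeE e1pp j * ∑ n₁ ∈ F, varpi2 c' χ j n₁ * nuConvChi χ n₁ / (n₁ : ℂ) =
      (X - ∑ n₁ ∈ F, varpi2 c' χ j n₁ / (n₁ : ℂ) * In n₁) +
        ∑ n₁ ∈ F, varpi2 c' χ j n₁ / (n₁ : ℂ) * (In n₁ - frakeE e1pp j * nuConvChi χ n₁) := by
    have e1 : ∑ n₁ ∈ F, varpi2 c' χ j n₁ / (n₁ : ℂ) * (In n₁ - frakeE e1pp j * nuConvChi χ n₁) =
        ∑ n₁ ∈ F, varpi2 c' χ j n₁ / (n₁ : ℂ) * In n₁ -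
          ∑ n₁ ∈ F, varpi2 c' χ j n₁ / (n₁ : ℂ) * (frakeE e1pp j * nuConvChi χ n₁) := by
      rw [← Finset.sum_sub_distrib]
      exact Finset.sum_congr rfl fun _ _ => by ring
    have e2 : frakeE e1pp j * ∑ n₁ ∈ F, varpi2 c' χ j n₁ * nuConvChi χ n₁ / (n₁ : ℂ) =
        ∑ n₁ ∈ F, varpi2 c' χ j n₁ / (n₁ : ℂ) * (frakeE e1pp j * nuConvChi χ n₁) := by
      rw [Finset.mul_sum]
      exact Finset.sum_congr rfl fun _ _ => by ring
    rw [e1, e2]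
    ring
  rw [hsplit]
  -- main estimate
  have hterm : ∀ n₁ ∈ F, ‖varpi2 c' χ j n₁ / (n₁ : ℂ) * (In n₁ - frakeE e1pp j * nuConvChi χ n₁)‖ ≤
      ‖varpi2 c' χ j n₁‖ * tau3R n₁ / n₁ * (|C₂| * (ell D ^ 7)⁻¹) +
        ‖varpi2 c' χ j n₁‖ * tau3R n₁ / n₁ * (|C₂| * (D : ℝ) ^ (-c₂)) := by
    intro n₁ hn₁
    obtain ⟨hIco, _⟩ := Finset.mem_filter.mp hn₁
    have h1 : 1 ≤ n₁ := (Finset.mem_Ico.mp hIco).1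
    have hn0 : (0 : ℝ) < n₁ := by exact_mod_cast h1
    rw [norm_mul, norm_div, Complex.norm_natCast]
    have hτ := one_le_tau3R' h1
    have hϖ : 0 ≤ ‖varpi2 c' χ j n₁‖ / n₁ := by positivity
    calc ‖varpi2 c' χ j n₁‖ / ↑n₁ * ‖In n₁ - frakeE e1pp j * nuConvChi χ n₁‖
        ≤ ‖varpi2 c' χ j n₁‖ / ↑n₁ * (|C₂| * (tau3R n₁ * (ell D ^ 7)⁻¹ + (D : ℝ) ^ (-c₂))) :=
          mul_le_mul_of_nonneg_left (e37 n₁ hn₁) hϖ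
      _ = ‖varpi2 c' χ j n₁‖ * tau3R n₁ / n₁ * (|C₂| * (ell D ^ 7)⁻¹) +
            ‖varpi2 c' χ j n₁‖ / n₁ * (|C₂| * (D : ℝ) ^ (-c₂)) := by ring
      _ ≤ ‖varpi2 c' χ j n₁‖ * tau3R n₁ / n₁ * (|C₂| * (ell D ^ 7)⁻¹) +
            ‖varpi2 c' χ j n₁‖ * tau3R n₁ / n₁ * (|C₂| * (D : ℝ) ^ (-c₂)) := by
          have hdiv : ‖varpi2 c' χ j n₁‖ / n₁ ≤ ‖varpi2 c' χ j n₁‖ * tau3R n₁ / n₁ := by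
            apply div_le_div_of_nonneg_right _ hn0.le
            calc ‖varpi2 c' χ j n₁‖ = ‖varpi2 c' χ j n₁‖ * 1 := (mul_one _).symm
              _ ≤ ‖varpi2 c' χ j n₁‖ * tau3R n₁ := mul_le_mul_of_nonneg_left hτ (norm_nonneg _)
          have hD0 : 0 ≤ |C₂| * (D : ℝ) ^ (-c₂) :=
            mul_nonneg (abs_nonneg _) (Real.rpow_nonneg (Nat.cast_nonneg D) _)
          have := mul_le_mul_of_nonneg_right hdiv hD0
          linarith
  have hsumS : 0 ≤ ∑ n₁ ∈ F, ‖varpi2 c' χ j n₁‖ * tau3R n₁ / n₁ :=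
    Finset.sum_nonneg fun n₁ _ => by
      have := tau3R_nonneg' n₁; positivity
  have eS' : ∑ n₁ ∈ F, ‖varpi2 c' χ j n₁‖ * tau3R n₁ / n₁ ≤ |C₃| * ell D ^ 6 :=
    le_trans eS (mul_le_mul_of_nonneg_right (le_abs_self C₃) (by positivity))
  have hexp1 : Real.exp (-c₁ * ell D ^ (1 / 10 : ℝ)) ≤ (Nat.factorial 10 : ℝ) / c₁ ^ 10 * (ell D)⁻¹ :=
    exp_neg_mul_rpow_tenth_le hc₁ hℓ0
  have hexp2 : (D : ℝ) ^ (-c₂) * ell D ^ 6 ≤ (Nat.factorial 7 : ℝ) / c₂ ^ 7 * (ell D)⁻¹ :=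
    rpow_neg_mul_pow_six_le' hc₂ hℓ0
  have hDc₁ : 0 ≤ Real.exp (-c₁ * ell D ^ (1 / 10 : ℝ)) := Real.exp_nonneg _
  have hDc₂ : 0 ≤ (D : ℝ) ^ (-c₂) := Real.rpow_nonneg (Nat.cast_nonneg D) _
  calc ‖(X - ∑ n₁ ∈ F, varpi2 c' χ j n₁ / (n₁ : ℂ) * In n₁) +
          ∑ n₁ ∈ F, varpi2 c' χ j n₁ / (n₁ : ℂ) * (In n₁ - frakeE e1pp j * nuConvChi χ n₁)‖
      ≤ ‖X - ∑ n₁ ∈ F, varpi2 c' χ j n₁ / (n₁ : ℂ) * In n₁‖ +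
          ∑ n₁ ∈ F, ‖varpi2 c' χ j n₁ / (n₁ : ℂ) * (In n₁ - frakeE e1pp j * nuConvChi χ n₁)‖ :=
        le_trans (norm_add_le _ _) (by gcongr; exact norm_sum_le _ _)
    _ ≤ C₁ * Real.exp (-c₁ * ell D ^ (1 / 10 : ℝ)) +
          ∑ n₁ ∈ F, (‖varpi2 c' χ j n₁‖ * tau3R n₁ / n₁ * (|C₂| * (ell D ^ 7)⁻¹) +
            ‖varpi2 c' χ j n₁‖ * tau3R n₁ / n₁ * (|C₂| * (D : ℝ) ^ (-c₂))) :=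
        add_le_add e31 (Finset.sum_le_sum hterm)
    _ = C₁ * Real.exp (-c₁ * ell D ^ (1 / 10 : ℝ)) +
          (∑ n₁ ∈ F, ‖varpi2 c' χ j n₁‖ * tau3R n₁ / n₁) *
            (|C₂| * (ell D ^ 7)⁻¹ + |C₂| * (D : ℝ) ^ (-c₂)) := by
        rw [Finset.sum_add_distrib, ← Finset.sum_mul, ← Finset.sum_mul]; ring
    _ ≤ |C₁| * Real.exp (-c₁ * ell D ^ (1 / 10 : ℝ)) +
          (|C₃| * ell D ^ 6) * (|C₂| * (ell D ^ 7)⁻¹ + |C₂| * (D : ℝ) ^ (-c₂)) := by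
        have i1 : C₁ * Real.exp (-c₁ * ell D ^ (1 / 10 : ℝ)) ≤
            |C₁| * Real.exp (-c₁ * ell D ^ (1 / 10 : ℝ)) :=
          mul_le_mul_of_nonneg_right (le_abs_self _) hDc₁
        have i2 : (∑ n₁ ∈ F, ‖varpi2 c' χ j n₁‖ * tau3R n₁ / n₁) *
              (|C₂| * (ell D ^ 7)⁻¹ + |C₂| * (D : ℝ) ^ (-c₂)) ≤
            (|C₃| * ell D ^ 6) * (|C₂| * (ell D ^ 7)⁻¹ + |C₂| * (D : ℝ) ^ (-c₂)) :=
          mul_le_mul_of_nonneg_right eS' (by positivity)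
        linarith
    _ = |C₁| * Real.exp (-c₁ * ell D ^ (1 / 10 : ℝ)) + |C₂| * |C₃| * (ell D ^ 6 * (ell D ^ 7)⁻¹) +
          |C₂| * |C₃| * ((D : ℝ) ^ (-c₂) * ell D ^ 6) := by ring
    _ ≤ |C₁| * ((Nat.factorial 10 : ℝ) / c₁ ^ 10 * (ell D)⁻¹) + |C₂| * |C₃| * (ell D)⁻¹ +
          |C₂| * |C₃| * ((Nat.factorial 7 : ℝ) / c₂ ^ 7 * (ell D)⁻¹) := by
        have e6 : ell D ^ 6 * (ell D ^ 7)⁻¹ = (ell D)⁻¹ := by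
          rw [show ell D ^ 7 = ell D ^ 6 * ell D by ring, mul_inv, ← mul_assoc,
            mul_inv_cancel₀ (pow_ne_zero 6 hℓ0.ne'), one_mul]
        rw [e6]
        have i1 := mul_le_mul_of_nonneg_left hexp1 (abs_nonneg C₁)
        have i3 := mul_le_mul_of_nonneg_left hexp2 (mul_nonneg (abs_nonneg C₂) (abs_nonneg C₃))
        linarith
    _ = (|C₁| * ((Nat.factorial 10 : ℝ) / c₁ ^ 10) + |C₂| * |C₃| * (1 + (Nat.factorial 7 : ℝ) / c₂ ^ 7)) *
          (ell D)⁻¹ := by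
        field_simp
        ring



/-- **The summed edge to (16.15) from the `ε₁`-rate u031** (plain form): `Step16_u031Lε → Step16_u037RL →
Inline16_varpi2WeightSum → Eq16_15` — the instance `e1pp = e1ppj` of `eq16_15E_of_repairLε` (`rfl` bridges
`step16_u037RLE_e1ppj`, `eq16_15E_e1ppj`). [cite: Zhang2022LandauSiegel, §16 (16.15) p.94] -/
theorem eq16_15_of_repairLε (c' : ℝ) (h31 : Step16_u031Lε c') (h37 : Step16_u037RL c')
    (hS : Inline16_varpi2WeightSum c') : Eq16_15 c' :=
  eq16_15E_of_repairLε e1ppj c' h31 h37 hS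

end EdgeEps

end Literature.NumberTheory.LFunctions.Zhang2022.Typed.Section16B
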